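import Summits.QuantumFields.BalabanUV.T4Continuum.Support.UrsellTermBudget
import Summits.QuantumFields.BalabanUV.T4Continuum.Support.B13ActMajorantLevels

/-!
# NE5 ∕ U3 — convergence of the ORDERED series (2.13), part 3b: the same budget in leaf-04's LEVELWISE currency
# (`B13ActMajorantLevels`, p208829), and the identification of the two polymer weights

Cell `pub-balaban`, unit `b2b-balaban-t4-ne5-formalise-leaf-08` (NE5 formalisation swarm, LEAF PROVER 08; row O1-d2 follower (iii);
parts 1–3 = `Support/UrsellTreeSum` p208810, `Support/UrsellSeriesBound` p209076, `Support/UrsellTermBudget` p209547).  Summits-side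
NEW WORK under the LEAN PLACEMENT RULE (cell bookkeeping).  HONEST FRAMING: rung (B)+1 of the FINITE-VOLUME T⁴ continuum programme —
NOT infinite volume, NOT a mass gap, NOT the Clay problem, NOT a proof of NE5.  HONEST DEPENDENCY (cell line, verbatim): continuum
YM on T⁴ ⇐ BetaPertH ∧ nine spine estimates (0/9 proved); BetaPertH ⇐ (D1) ∧ (D4) ∧ CAP+tail; G-an2-4 gates asym, D1 and NE2/3/4.

WHAT.  Part 3 (`UrsellTermBudget`, written in parallel with leaf-04's `B13ActMajorantLevels`) carries its own copy `actSum` of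
leaf-04's polymer weight `polyWeight` and its own level identity `level_eq`.  This file records, with NO new definitions, that the
two currencies coincide and hands part 3's bound to leaf-04's LEVELWISE consumers BY NAME:
* `actSum_eq_polyWeight` (`rfl`), `rhoT_touchInc_eq` (leaf-08's generic `ρᵀ` at the socket's hard core IS leaf-02's `rhoT G`, `rfl`);
* `levelMajorant_le` — leaf-04's `levelMajorant G D A k X n ≤ UrsellSeriesBound.levelMajorant ν Φ n = Φ·(4νΦ)^n` at every step-`k`
  domain, from the activity-level anchored exponential norm (part 3's `level_le`, transported along the two `rfl`s);
* `summable_levelMajorant_socket`, `tsum_levelMajorant_socket_le` (`∑' n ≤ Φ/(1 − 4νΦ)`) — binders `hlev`∕`hbud` of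
  `B13ActMajorantLevels.termRep_socket_of_levelBound` ∕ `classBound_socket_of_levelBudget` as THEOREMS (decay rate `κ = 0`; the
  rate of (2.41) p. 21 is the displayed geometric step (2.27)∕(2.40), not extracted here);
* `termRep_socket_of_actNorm`, `classBound_socket_of_actNorm` — the two leaf-04 payoffs fired with them.
Nothing of the manuscripts under audit is asserted ([Balaban1988RG2Cluster] cited for FORM∕locus only).  No definitions; 0 sorry;
axioms ⊆ {propext, Classical.choice, Quot.sound}.
-/

noncomputable section

open Finset
open scoped BigOperators

namespace Summit.QuantumFields.BalabanUV.T4Continuum.UrsellTermBudget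

open Literature.MathematicalPhysics.QuantumFieldTheory.Balaban1983to89.T4OutputRate (Carriers)
open Literature.MathematicalPhysics.QuantumFieldTheory.Balaban1983to89.T4InputCauchyRateData (StepModel)
open Literature.MathematicalPhysics.QuantumFieldTheory.Balaban1983to89.T4InputCauchyRateSpecies (ClassBound)
open Literature.MathematicalPhysics.QuantumFieldTheory.Balaban1983to89.T4InputCauchyRateTermwise (TermRep)
open Summit.QuantumFields.BalabanUV.T4Continuum.ClusterRepOfDomains (DomainGeometry)
open Summit.QuantumFields.BalabanUV.T4Continuum.B13StepTermLabels
open Summit.QuantumFields.BalabanUV.T4Continuum.B13StepTermSocket (labelsIndexing touchInc)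
open Summit.QuantumFields.BalabanUV.T4Continuum.B13ActMajorantLevels (polyWeight termRep_socket_of_levelBound
  classBound_socket_of_levelBudget)
open Summit.QuantumFields.BalabanUV.T4Continuum.UrsellTreeSum (ind)
open Summit.QuantumFields.BalabanUV.T4Continuum.UrsellSeriesBound (summable_levelMajorant tsum_levelMajorant)

variable {C : Carriers} [DecidableEq C.Dom] {Cube : Type*} [DecidableEq Cube] {Bnd : Type*} [DecidableEq Bnd]
  (G : DomainGeometry C Cube) (D : InnerData C Bnd) (A : C.Dom → InnerLabel C.Dom Bnd → ℝ)

/-! ## §1 The two currencies coincide -/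

omit [DecidableEq Cube] in
/-- [folklore] Part 3's activity-level majorant IS leaf-04's polymer weight (same printed object, (2.9)∕(2.38): `Σ_{ℓ ∈ innerLabels} A Z ℓ`). -/
theorem actSum_eq_polyWeight (k : ℕ) (Z : C.Dom) : actSum D A k Z = polyWeight D A k Z := rfl

/-- [folklore] leaf-08's generic `ρᵀ` (`B13StepTermFamily.rhoT`) at the socket's hard core `touchInc G` IS leaf-02's `rhoT G` ((2.12)). -/
theorem rhoT_touchInc_eq {n : ℕ} (Z : Fin (n + 1) → C.Dom) : B13StepTermFamily.rhoT (touchInc G) Z = rhoT G Z := rfl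

/-! ## §2 Part 3's level bound and budget in the LEVELWISE currency -/

/-- [folklore] **THE LEVEL BOUND, levelwise currency**: `B13ActMajorantLevels.levelMajorant G D A k X n ≤ Φ·(4νΦ)^n` at every step-`k`
domain `X`, from a footprint-local reach (`#reach ≤ ν·#cubes`) and the anchored exponential norm
`Σ_{Z ∈ level k, Z ∋ q} polyWeight(Z)·e^{#cubes Z} ≤ Φ` of a nonnegative activity-term majorant (part 3's `level_le`). -/
theorem levelMajorant_le (reach : C.Dom → Finset Cube) {ν Φ : ℝ} (hA : ∀ Z ℓ, 0 ≤ A Z ℓ)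
    (hloc : ∀ Z Z', touchInc G Z' Z → ∃ q ∈ reach Z, q ∈ G.cubes Z') (hν : 0 ≤ ν)
    (hreach : ∀ Z, ((reach Z).card : ℝ) ≤ ν * (G.cubes Z).card) (hΦ0 : 0 ≤ Φ) {k : ℕ}
    (hΦ : ∀ q : Cube, ∑ Z ∈ G.level k, ind (q ∈ G.cubes Z) * polyWeight D A k Z * Real.exp ((G.cubes Z).card) ≤ Φ)
    {X : C.Dom} (hX : C.scale X = k) (n : ℕ) :
    B13ActMajorantLevels.levelMajorant G D A k X n ≤ UrsellSeriesBound.levelMajorant ν Φ n :=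
  level_le G D A reach hA hloc hν hreach hΦ0 hΦ hX n

/-- [folklore] **LEVELWISE SUMMABILITY** (binder `hlev` of `B13ActMajorantLevels.termRep_socket_of_levelBound`): at a step-`k` domain the
level majorants are summable in the number of factors when `4νΦ < 1`. -/
theorem summable_levelMajorant_socket (reach : C.Dom → Finset Cube) {ν Φ : ℝ} (hA : ∀ Z ℓ, 0 ≤ A Z ℓ)
    (hloc : ∀ Z Z', touchInc G Z' Z → ∃ q ∈ reach Z, q ∈ G.cubes Z') (hν : 0 ≤ ν)
    (hreach : ∀ Z, ((reach Z).card : ℝ) ≤ ν * (G.cubes Z).card) (hΦ0 : 0 ≤ Φ) (hsmall : 4 * ν * Φ < 1) {k : ℕ}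
    (hΦ : ∀ q : Cube, ∑ Z ∈ G.level k, ind (q ∈ G.cubes Z) * polyWeight D A k Z * Real.exp ((G.cubes Z).card) ≤ Φ)
    {X : C.Dom} (hX : C.scale X = k) : Summable (B13ActMajorantLevels.levelMajorant G D A k X) :=
  Summable.of_nonneg_of_le (B13ActMajorantLevels.levelMajorant_nonneg hA k X)
    (levelMajorant_le G D A reach hA hloc hν hreach hΦ0 hΦ hX) (summable_levelMajorant hν hΦ0 hsmall)

/-- [folklore] **THE LEVELWISE PER-DOMAIN BUDGET (decay rate 0)** (binder `hbud` of `B13ActMajorantLevels.classBound_socket_of_levelBudget`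
at `κ = 0`, `G′ = Φ/(1 − 4νΦ)`): `∑' n, levelMajorant G D A k X n ≤ Φ/(1 − 4νΦ)` at every step-`k` domain. -/
theorem tsum_levelMajorant_socket_le (reach : C.Dom → Finset Cube) {ν Φ : ℝ} (hA : ∀ Z ℓ, 0 ≤ A Z ℓ)
    (hloc : ∀ Z Z', touchInc G Z' Z → ∃ q ∈ reach Z, q ∈ G.cubes Z') (hν : 0 ≤ ν)
    (hreach : ∀ Z, ((reach Z).card : ℝ) ≤ ν * (G.cubes Z).card) (hΦ0 : 0 ≤ Φ) (hsmall : 4 * ν * Φ < 1) {k : ℕ}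
    (hΦ : ∀ q : Cube, ∑ Z ∈ G.level k, ind (q ∈ G.cubes Z) * polyWeight D A k Z * Real.exp ((G.cubes Z).card) ≤ Φ)
    {X : C.Dom} (hX : C.scale X = k) : ∑' n, B13ActMajorantLevels.levelMajorant G D A k X n ≤ Φ / (1 - 4 * ν * Φ) := by
  rw [← tsum_levelMajorant hν hΦ0 hsmall]
  exact Summable.tsum_le_tsum (fun n => levelMajorant_le G D A reach hA hloc hν hreach hΦ0 hΦ hX n)
    (summable_levelMajorant_socket G D A reach hA hloc hν hreach hΦ0 hsmall hΦ hX) (summable_levelMajorant hν hΦ0 hsmall)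

/-! ## §3 leaf-04's levelwise payoffs fired -/

section Payoff

variable {Op Hist : Type*} [NormedAddCommGroup Op] [NormedSpace ℂ Op] [NormedAddCommGroup Hist] [NormedSpace ℂ Hist]

/-- [folklore] **`TermRep` ON THE SOCKET FROM THE ACTIVITY MAJORANT ALONE, via the levelwise payoff**: a nonnegative activity-term majorant
`𝒜 k g U` at the class points (the SHAPE of [Balaban1988RG2Cluster] Lemma 3 (2.38) p. 20 — displayed, locator only) with anchored
exponential norm `Φ`, `4νΦ < 1`, on every step catalogue ⟹ `TermRep M K (term (labelsIndexing G D) (touchInc G) act) W`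
(`B13ActMajorantLevels.termRep_socket_of_levelBound` with `hlev := summable_levelMajorant_socket`). -/
theorem termRep_socket_of_actNorm (act : C.Dom → InnerLabel C.Dom Bnd → Op → Hist → ℂ) {M : StepModel C Op Hist}
    (hM : ∀ k o h X, M.Out k o h X = B13StepTermFamily.out (labelsIndexing G D) (touchInc G) act k o h X)
    {K : ℕ → (ℕ → ℝ) → C.BgB → Set (Op × Hist)} {W : Set (ℕ → ℝ)} {𝒜 : ℕ → (ℕ → ℝ) → C.BgB → C.Dom → InnerLabel C.Dom Bnd → ℝ}
    (hA0 : ∀ k g U Z ℓ, 0 ≤ 𝒜 k g U Z ℓ)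
    (hA : ∀ k, ∀ g ∈ W, ∀ (U : C.BgB) (q : Op × Hist), q ∈ K k g U → ∀ X : C.Dom, C.scale X = k →
      ∀ i : TermIdx C.Dom Bnd, (labelsIndexing G D).Rel k i X →
        ∀ m, ‖act ((labelsIndexing G D).poly i m) ((labelsIndexing G D).lab i m) q.1 q.2‖ ≤
          𝒜 k g U ((labelsIndexing G D).poly i m) ((labelsIndexing G D).lab i m))
    (reach : C.Dom → Finset Cube) {ν Φ : ℝ} (hloc : ∀ Z Z', touchInc G Z' Z → ∃ q ∈ reach Z, q ∈ G.cubes Z') (hν : 0 ≤ ν)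
    (hreach : ∀ Z, ((reach Z).card : ℝ) ≤ ν * (G.cubes Z).card) (hΦ0 : 0 ≤ Φ) (hsmall : 4 * ν * Φ < 1)
    (hΦ : ∀ k, ∀ g ∈ W, ∀ (U : C.BgB) (q : Cube),
      ∑ Z ∈ G.level k, ind (q ∈ G.cubes Z) * polyWeight D (𝒜 k g U) k Z * Real.exp ((G.cubes Z).card) ≤ Φ) :
    TermRep M K (B13StepTermFamily.term (labelsIndexing G D) (touchInc G) act) W :=
  termRep_socket_of_levelBound act hM hA0 hA fun k g hg U _ hX =>
    summable_levelMajorant_socket G D (𝒜 k g U) reach (hA0 k g U) hloc hν hreach hΦ0 hsmall (hΦ k g hg U) hX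

/-- [folklore] **`ClassBound M K W 0 (Φ/(1 − 4νΦ))` ON THE SOCKET FROM THE ACTIVITY MAJORANT ALONE, via the levelwise payoff**
(`B13ActMajorantLevels.classBound_socket_of_levelBudget` at `κ = 0` with `hbud := ⟨summable_levelMajorant_socket, tsum_levelMajorant_socket_le⟩`). -/
theorem classBound_socket_of_actNorm (act : C.Dom → InnerLabel C.Dom Bnd → Op → Hist → ℂ) {M : StepModel C Op Hist}
    (hM : ∀ k o h X, M.Out k o h X = B13StepTermFamily.out (labelsIndexing G D) (touchInc G) act k o h X)
    {K : ℕ → (ℕ → ℝ) → C.BgB → Set (Op × Hist)} {W : Set (ℕ → ℝ)} {𝒜 : ℕ → (ℕ → ℝ) → C.BgB → C.Dom → InnerLabel C.Dom Bnd → ℝ}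
    (hA0 : ∀ k g U Z ℓ, 0 ≤ 𝒜 k g U Z ℓ)
    (hA : ∀ k, ∀ g ∈ W, ∀ (U : C.BgB) (q : Op × Hist), q ∈ K k g U → ∀ X : C.Dom, C.scale X = k →
      ∀ i : TermIdx C.Dom Bnd, (labelsIndexing G D).Rel k i X →
        ∀ m, ‖act ((labelsIndexing G D).poly i m) ((labelsIndexing G D).lab i m) q.1 q.2‖ ≤
          𝒜 k g U ((labelsIndexing G D).poly i m) ((labelsIndexing G D).lab i m))
    (reach : C.Dom → Finset Cube) {ν Φ : ℝ} (hloc : ∀ Z Z', touchInc G Z' Z → ∃ q ∈ reach Z, q ∈ G.cubes Z') (hν : 0 ≤ ν)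
    (hreach : ∀ Z, ((reach Z).card : ℝ) ≤ ν * (G.cubes Z).card) (hΦ0 : 0 ≤ Φ) (hsmall : 4 * ν * Φ < 1)
    (hΦ : ∀ k, ∀ g ∈ W, ∀ (U : C.BgB) (q : Cube),
      ∑ Z ∈ G.level k, ind (q ∈ G.cubes Z) * polyWeight D (𝒜 k g U) k Z * Real.exp ((G.cubes Z).card) ≤ Φ) :
    ClassBound M K W 0 (Φ / (1 - 4 * ν * Φ)) :=
  classBound_socket_of_levelBudget act hM hA0 hA fun k g hg U _ hX =>
    ⟨summable_levelMajorant_socket G D (𝒜 k g U) reach (hA0 k g U) hloc hν hreach hΦ0 hsmall (hΦ k g hg U) hX, by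
      rw [zero_mul, neg_zero, Real.exp_zero, mul_one]
      exact tsum_levelMajorant_socket_le G D (𝒜 k g U) reach (hA0 k g U) hloc hν hreach hΦ0 hsmall (hΦ k g hg U) hX⟩

end Payoff

end Summit.QuantumFields.BalabanUV.T4Continuum.UrsellTermBudget

end
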